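import Literature.AnabelianGeometry.EtaleTheta.ThetaFractionPairOfThetaTwistTower
import Literature.AnabelianGeometry.EtaleTheta.Discharge.Sec4Prop42iiiThetaTwistTowerQuotient
import Literature.AnabelianGeometry.EtaleTheta.Discharge.Sec5ThetaZerosPullInvariantThetaTwistTower
import HarnessLib

/-!
# [EtTh] Prop. 4.2 (iii) WITH CONTENT at the FOURTH tower model: the theta function `Θ̈ ∈ O^×(A_⊙^birat)` and its fraction-pair
# `(s′, s″)` HAVE `N`-th ROOTS for every `N ≥ 1` — the §5 root data `Rl` of the theta function exist at a tower model of record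

S. Mochizuki, *The étale theta function …*, Publ. RIMS **45** (2009) [MochizukiEtTh2009], Prop. 4.2 (iii) p.314 (PDF p.88) («There exist
commutative diagrams … an `N`-th root of the fraction-pair»), Def. 4.1 (i) p.312 (PDF p.86), §5 pp.330–331 (PDF pp.104–105) (the `l`-th roots
of the theta function over `A_⊙`, `s′_l, s″_l`).  [cite: MochizukiEtTh2009, Prop 4.2 (iii) p.88]
PAGE CONVENTION for [EtTh]: «printed N (PDF p.M)», N = M + 226.

PROOF-ONLY (theorems only; abc-iut cell, layer L2, seat abc-iut-L2-d2 gen 8; abc-iut-L2-lead R1224 / plan/L2/SUBDAG-EtTh-JUNCTION.md slot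
D5 = (O6), FILE B1).  Consumed BY NAME, nothing restated: this seat's FILE A1/A2 (`Aodot n = (Y_n, 0)`, `thetaUnit`, `thetaFractionPair`,
p505973 + sequel), abc-iut-w6-d037's POSITIVE Prop. 4.2 (iii) instances at the fourth model `prop42_iii_mkOfQuotientTemperoid(_quotConnZeroObj)`
(p501897 ⟸ p499861 ⟸ gen-7 MU-TORSION p500836 / knit p501418 ⟸ p496075), gen-7's free-Galois socket `prop42_iii` (p501418, mod the displayed
naturality datum `hS`).
* §1 **`nonempty_nthRoot_theta`** — over abc-iut-L2-t3's quotient-temperoid §4 setting at the anchor `A_⊙ = (Compat₃′/V_n, 0)` (continuous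
  SURJECTION `φ : Π^tp_X ↠ Compat₃′` displayed — «onto-socket: design-only» per R1257), the fraction-pair of the theta function admits an
  `N`-th root for EVERY `N ≥ 1`: the FIRST `NthRoot` datum in the tree over a non-trivial function (print's `(A_l, B_l, s′_l, s″_l)` of §5 at
  `N := l`); `exists_nthRoot_theta` (∃-form), and the free-socket twin `nonempty_nthRoot_theta_mkOfModelCanonical` (mod `hS`).
WHAT THIS DOES NOT GIVE (recorded, not hidden): the §5 datum `R : NthRoot Rl.root Rl.pair N` of abc-iut-L2-t3's `ofQuotientTemperoidData`
(the `N`-th root OF the `l`-th root, domain `A_l ≠ A_⊙`) is NOT produced by the typed `Prop42_iii`, which quantifies over fraction-pairs with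
domain `A_⊙` only; a producer for Frobenius-trivial Galois `H_⊙`-ample domains `A ≠ A_⊙` (print applies (iii) again over `A_l`), or an
`(l·N)`-th root read of the junction, is the next slot.  HONEST FRAMING: class-(b) combinatorial DESIGN carrier (NOT the tempered Frobenioid of a
Tate curve); roots exist by the kernel-checked Prop. 4.2 (iii) instance at OUR model, their data are not exhibited here (`Nonempty`); nothing here
bears on [IUTchIII] Cor. 3.12; no side taken; typed ≠ proved.
-/

noncomputable section

namespace Literature.AnabelianGeometry.EtaleTheta

open CategoryTheory Opposite Function Literature.AlgebraicGeometry.Frobenioids Literature.AlgebraicGeometry.Frobenioids.QuasiTemperoid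
  Literature.AnabelianGeometry.SemiGraphs LogDivisorModel LogDivisorModel.GaloisAction LogDivisorTower

namespace ThetaTwistTowerTempered

open LogDivisorModel.TateTowerThetaTwist TateTowerKummerTwistRShear

variable (R S : ((ConnectedPart (BTemp (Compat 3 thetaShear)))ᵒᵖ ⥤ CommMonCat.{0}) → Prop) (n : ℕ)
  {K : Type 1} [Field K] (X : SemiGraphs.TemperedArithmeticGroup.{1} K)

/-! ## §1 Roots of the theta function's fraction-pair, for every `N ≥ 1` -/

/-- **[EtTh] Prop. 4.2 (iii) WITH CONTENT: over the quotient-temperoid §4 setting at `A_⊙ = (Compat₃′/V_n, 0)` the fraction-pair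
`(s′, s″)` of the theta function `Θ̈ ∈ O^×(A_⊙^birat)` has an `N`-th root for EVERY `N ≥ 1`** (abc-iut-w6-d037's instance fed with FILE A2's
datum) — print's `l`-th root data `(A_l, B_l, s′_l, s″_l)` of §5 at `N := l`. [cite: MochizukiEtTh2009, Prop 4.2 (iii) p.88] -/
theorem nonempty_nthRoot_theta (φ : X.Pi →ₜ* Compat 3 thetaShear) (hφ : Function.Surjective φ) (N : ℕ+) :
    Nonempty ((BiKummerSetting.mkOfQuotientTemperoid X (isTemperedC 3 thetaShear) φ hφ (ThetaTwistTowerTempered.temperedFrobenioid R S)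
        (monoidType_eq R S) (hP R S) (fun _ _ _ => True)
        ((ThetaTwistTowerTempered.temperedFrobenioid R S).quotConnZeroObj (isTemperedC 3 thetaShear) (vOpenNormal 3 thetaShear n))
        ((ThetaTwistTowerTempered.temperedFrobenioid R S).isFrobeniusTrivial_quotConnZeroObj (isTemperedC 3 thetaShear)
          (vOpenNormal 3 thetaShear n))
        ((ThetaTwistTowerTempered.temperedFrobenioid R S).isGaloisObj_quotConnZeroObj_base (isTemperedC 3 thetaShear)
          (vOpenNormal 3 thetaShear n))).NthRoot
      (thetaUnit R S n) (thetaFractionPair R S n X _ _ _ (fun _ _ _ => True) _ (isFrobeniusTrivial_Aodot R S n) (isGaloisObj_Aodot_base R S n)) N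
      (fun {_} ψ x => (ThetaTwistTowerTempered.temperedFrobenioid R S).pullFracModel ψ x)) :=
  prop42_iii_mkOfQuotientTemperoid_quotConnZeroObj R S X φ hφ (vOpenNormal 3 thetaShear n) (thetaUnit R S n) _ N

/-- ∃-form: roots of every order of the theta function's fraction-pair exist. [cite: MochizukiEtTh2009, Prop 4.2 (iii) p.88] -/
theorem exists_nthRoot_theta (φ : X.Pi →ₜ* Compat 3 thetaShear) (hφ : Function.Surjective φ) (N : ℕ+) :
    ∃ _ : (BiKummerSetting.mkOfQuotientTemperoid X (isTemperedC 3 thetaShear) φ hφ (ThetaTwistTowerTempered.temperedFrobenioid R S)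
        (monoidType_eq R S) (hP R S) (fun _ _ _ => True)
        ((ThetaTwistTowerTempered.temperedFrobenioid R S).quotConnZeroObj (isTemperedC 3 thetaShear) (vOpenNormal 3 thetaShear n))
        ((ThetaTwistTowerTempered.temperedFrobenioid R S).isFrobeniusTrivial_quotConnZeroObj (isTemperedC 3 thetaShear)
          (vOpenNormal 3 thetaShear n))
        ((ThetaTwistTowerTempered.temperedFrobenioid R S).isGaloisObj_quotConnZeroObj_base (isTemperedC 3 thetaShear)
          (vOpenNormal 3 thetaShear n))).NthRoot
      (thetaUnit R S n) (thetaFractionPair R S n X _ _ _ (fun _ _ _ => True) _ (isFrobeniusTrivial_Aodot R S n) (isGaloisObj_Aodot_base R S n)) N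
      (fun {_} ψ x => (ThetaTwistTowerTempered.temperedFrobenioid R S).pullFracModel ψ x), True :=
  ⟨(nonempty_nthRoot_theta R S n X φ hφ N).some, trivial⟩

variable (gS : ∀ A : ConnectedPart (BTemp (Compat 3 thetaShear)),
    IsGaloisObj ((ThetaTwistTowerTempered.temperedFrobenioid R S).base.obj A).obj → (X.Pi →* Aut A))
  (gSs : ∀ (A : ConnectedPart (BTemp (Compat 3 thetaShear)))
    (h : IsGaloisObj ((ThetaTwistTowerTempered.temperedFrobenioid R S).base.obj A).obj), Function.Surjective (gS A h))

/-- **The free-Galois-socket twin** (gen-7's `prop42_iii` at the canonical §4 model `mkOfModelCanonical X tf … gS …` with anchor `(Y_n, 0)`,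
modulo the displayed Def. 4.1 (ii) naturality datum `hS` of the free Galois action): the theta function's fraction-pair has an `N`-th root for
every `N ≥ 1`. [cite: MochizukiEtTh2009, Prop 4.2 (iii) p.88] -/
theorem nonempty_nthRoot_theta_mkOfModelCanonical
    (hS : ∀ ⦃A B : ConnectedPart (BTemp (Compat 3 thetaShear))⦄
      (hA : IsGaloisObj ((ThetaTwistTowerTempered.temperedFrobenioid R S).base.obj A).obj)
      (hB : IsGaloisObj ((ThetaTwistTowerTempered.temperedFrobenioid R S).base.obj B).obj) (b : B ⟶ A),
      ∃ c : X.Pi, ∀ g : X.Pi, (gS B hB g).hom ≫ b = b ≫ (gS A hA (c * g * c⁻¹)).hom) (N : ℕ+) :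
    Nonempty ((BiKummerSetting.mkOfModelCanonical X (ThetaTwistTowerTempered.temperedFrobenioid R S) (monoidType_eq R S) (hP R S)
        (fun A => IsGaloisObj ((ThetaTwistTowerTempered.temperedFrobenioid R S).base.obj A).obj) gS gSs
        (fun _ _ _ => True) (Aodot R S n) (isFrobeniusTrivial_Aodot R S n) (isGaloisObj_Aodot_base R S n)).NthRoot
      (thetaUnit R S n) (thetaFractionPair R S n X _ gS gSs (fun _ _ _ => True) (Aodot R S n) (isFrobeniusTrivial_Aodot R S n)
        (isGaloisObj_Aodot_base R S n)) N
      (fun {_} ψ x => (ThetaTwistTowerTempered.temperedFrobenioid R S).pullFracModel ψ x)) :=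
  prop42_iii R S X gS gSs (Aodot R S n) (isFrobeniusTrivial_Aodot R S n) (isGaloisObj_Aodot_base R S n) hS (thetaUnit R S n) _ N


/-! ## §2 The junction binder `hθ` DISCHARGED for the theta function's fraction-pair, and `hinvc` for every root datum over it -/

/-- **`Div(s′)` — the class of the cusps — is FIXED by pull-back along EVERY endomorphism of `Y_n`** (abc-iut-L2-t11's
`pull_divisorMonoid_thetaZeros`, p501806, read at FILE A2's numerator pre-step: `Div(thetaNum) = ι(thetaZerosPhi)` definitionally).
[cite: MochizukiEtTh2009, §5 p.330 (PDF p.104)] -/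
theorem pull_div_thetaNum (g : YV n ⟶ YV n) :
    pull (ThetaTwistTowerTempered.temperedFrobenioid R S).divisorMonoid g (ModelFrobenioid.div (thetaNum R S n)) =
      ModelFrobenioid.div (thetaNum R S n) :=
  pull_divisorMonoid_thetaZeros R S g

/-- **The §5 junction binder `hθ` of abc-iut-L2-t3's `hinvc_ofQuotientTemperoid` / abc-iut-L2-t4's `hinvc_of_thetaDivisor` HOLDS for
the theta function's fraction-pair at the fourth model**: `Φ(ρ_{A_⊙}(x))(Div s′) = Div s′` for every `x ∈ Π^tp_X` (indeed for every
endomorphism of `A_⊙^bs = Y_n`; `s′ = thetaNum`, the numerator of `thetaFractionPair` definitionally).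
[cite: MochizukiEtTh2009, §5 p.330 (PDF p.104); Prop 4.3 (i) p.317 (PDF p.91)] -/
theorem hθ_thetaNum (φ : X.Pi →ₜ* Compat 3 thetaShear) (hφ : Function.Surjective φ) (x : X.Pi) :
    pull (ThetaTwistTowerTempered.temperedFrobenioid R S).divisorMonoid
        ((BiKummerSetting.mkOfQuotientTemperoid X (isTemperedC 3 thetaShear) φ hφ (ThetaTwistTowerTempered.temperedFrobenioid R S)
          (monoidType_eq R S) (hP R S) (fun _ _ _ => True)
          ((ThetaTwistTowerTempered.temperedFrobenioid R S).quotConnZeroObj (isTemperedC 3 thetaShear) (vOpenNormal 3 thetaShear n))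
          ((ThetaTwistTowerTempered.temperedFrobenioid R S).isFrobeniusTrivial_quotConnZeroObj (isTemperedC 3 thetaShear)
            (vOpenNormal 3 thetaShear n))
          ((ThetaTwistTowerTempered.temperedFrobenioid R S).isGaloisObj_quotConnZeroObj_base (isTemperedC 3 thetaShear)
            (vOpenNormal 3 thetaShear n))).galoisSurj
          ((ThetaTwistTowerTempered.temperedFrobenioid R S).quotConnZeroObj (isTemperedC 3 thetaShear) (vOpenNormal 3 thetaShear n)).base
          ((ThetaTwistTowerTempered.temperedFrobenioid R S).isGaloisObj_quotConnZeroObj_base (isTemperedC 3 thetaShear)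
            (vOpenNormal 3 thetaShear n)) x).hom
        (ModelFrobenioid.div (thetaNum R S n)) =
      ModelFrobenioid.div (thetaNum R S n) :=
  pull_div_thetaNum R S n _

/-- **`hinvc` for EVERY two-step root datum `A_⊙ ← A_l ← A_N` over the theta function's fraction-pair** (abc-iut-L2-t4's
`hinvc_of_thetaDivisor`: `Φ` divisorial — FILE 4 is a Frobenioid; outer naturality — abc-iut-L2-t3's `mkOfQuotientTemperoid_galoisSurj_natural`;
`hθ` — `hθ_thetaNum`; ANY birational transport datum `pullFrac`): `Φ(g)(Div s^⊓_N) = Div s^⊓_N` for all `g ∈ Aut_D(A_N^bs)` — the displayed binder `hinvc` of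
`ThetaFrobenioid.ofQuotientTemperoidData` at `f := Θ̈` holds with NO hypothesis beyond the root data themselves.
[cite: MochizukiEtTh2009, §5 p.330 (PDF p.104); Prop 4.3 (i) p.317 (PDF p.91)] -/
theorem hinvc_theta (φ : X.Pi →ₜ* Compat 3 thetaShear) (hφ : Function.Surjective φ)
    {pullFrac : ∀ {A A' : (ThetaTwistTowerTempered.temperedFrobenioid R S).category} (_ : A' ⟶ A),
      (ThetaTwistTowerTempered.temperedFrobenioid R S).biratUnitsModel A → (ThetaTwistTowerTempered.temperedFrobenioid R S).biratUnitsModel A'}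
    {lv N : ℕ+}
    (Rl : (BiKummerSetting.mkOfQuotientTemperoid X (isTemperedC 3 thetaShear) φ hφ (ThetaTwistTowerTempered.temperedFrobenioid R S)
        (monoidType_eq R S) (hP R S) (fun _ _ _ => True)
        ((ThetaTwistTowerTempered.temperedFrobenioid R S).quotConnZeroObj (isTemperedC 3 thetaShear) (vOpenNormal 3 thetaShear n))
        ((ThetaTwistTowerTempered.temperedFrobenioid R S).isFrobeniusTrivial_quotConnZeroObj (isTemperedC 3 thetaShear)
          (vOpenNormal 3 thetaShear n))
        ((ThetaTwistTowerTempered.temperedFrobenioid R S).isGaloisObj_quotConnZeroObj_base (isTemperedC 3 thetaShear)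
          (vOpenNormal 3 thetaShear n))).NthRoot
      (thetaUnit R S n) (thetaFractionPair R S n X _ _ _ (fun _ _ _ => True) _ (isFrobeniusTrivial_Aodot R S n) (isGaloisObj_Aodot_base R S n)) lv
      pullFrac)
    (Rt : (BiKummerSetting.mkOfQuotientTemperoid X (isTemperedC 3 thetaShear) φ hφ (ThetaTwistTowerTempered.temperedFrobenioid R S)
        (monoidType_eq R S) (hP R S) (fun _ _ _ => True)
        ((ThetaTwistTowerTempered.temperedFrobenioid R S).quotConnZeroObj (isTemperedC 3 thetaShear) (vOpenNormal 3 thetaShear n))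
        ((ThetaTwistTowerTempered.temperedFrobenioid R S).isFrobeniusTrivial_quotConnZeroObj (isTemperedC 3 thetaShear)
          (vOpenNormal 3 thetaShear n))
        ((ThetaTwistTowerTempered.temperedFrobenioid R S).isGaloisObj_quotConnZeroObj_base (isTemperedC 3 thetaShear)
          (vOpenNormal 3 thetaShear n))).NthRoot
      Rl.root Rl.pair N pullFrac)
    (g : Aut Rt.AN.base) :
    pull (ThetaTwistTowerTempered.temperedFrobenioid R S).divisorMonoid g.hom (ModelFrobenioid.div Rt.pair.num) =
      ModelFrobenioid.div Rt.pair.num :=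
  ThetaFrobenioid.hinvc_of_thetaDivisor Rt
    (fun W => TemperedFrobenioid.isDivisorial_divisorMonoid_of_isFrobenioid (isFrobenioid_temperedFrobenioid R S) W)
    (BiKummerSetting.mkOfQuotientTemperoid_galoisSurj_natural X (isTemperedC 3 thetaShear) φ hφ
      (ThetaTwistTowerTempered.temperedFrobenioid R S) (monoidType_eq R S) (hP R S) (fun _ _ _ => True) _ _ _)
    (hθ_thetaNum R S n X φ hφ) g

end ThetaTwistTowerTempered

end Literature.AnabelianGeometry.EtaleTheta

end
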